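import Mathlib
import HarnessLib
import Summits.ValiantsHypothesis.ValiantsHypothesis.Theorems.LacunarySymmetroidMatrixDescartesProductPlusOneRiccati

/-!
# ValiantsHypothesis / LacunarySymmetroid — crux `MatrixDescartes` (stmt-ValiantsHypothesis-18050, V1),
# LINE (A) «product_plus_one», floor at the TOP coupling: the AB-reduction for LOWER-SIGNED company (letter-partial sums, type-β windows)

Top-coupling twin of ✓ `…ProductPlusOneABWindow` (bottom, upper-signed rows) and ✓ `…ProductPlusOneABWindowMiddle` (middle, no-dip rows):
together the three files give «type-β windows carry at most one zero of the c-free Euler numerator» at ALL THREE couplings for K = 3.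
Setting: support `(d₀, d₀+p, d₀+q)` (`0 < p < q`), TOP coupling `l₀ = 2`, rows `f_j = a_{j0} x^{d₀} + a_{j1} x^{d₀+p} + a_{j2} x^{d₀+q}`, reduced rows
`g_j = a_{j0} + a_{j1} x^p + a_{j2} x^q`, LOWER-SIGNED company `a_{j0}·a_{j1} ≥ 0` (top coefficient FREE) — T1 ∪ T4 ∪ binomial companies coupled at
the TOP letter: the `x ↦ 1/x` image of val-idea-25 g3's AB sub-cell (✓ `…LowerSignedTop` closes the OTHER one, upper-signed at the top).
The top Euler letter is `X f′ − (d₀+q) f = −q a₀ x^{d₀} − (q−p) a₁ x^{d₀+p}`, so off the poles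

* (T0) `eulerRatioTop_eq_letterTerms`, `eulerNumeratorTop_eval_eq_zero_iff` — `x^q·Σ_j Φ_j^{top} = −(q·B₀ + (q−p)·x^p·B₁)` with the
  top-normalised LETTER-PARTIAL SUMS `B₀ = Σ_j a_{j0} x^q/g_j`, `B₁ = Σ_j a_{j1} x^q/g_j`; hence `R(x) = 0 ⟺ q B₀ + (q−p) x^p B₁ = 0`;
* (T1) `hasDerivAt_letterTermTop`, `letterSumsTop_monotone` — `(c x^q/g)′ = c x^{q−1}(q a₀ + (q−p) a₁ x^p)/g²`, so for lower-signed rows BOTH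
  `B₀` and `B₁` are ISOTONE on every pole-free interval `[u,v] ⊂ (0,∞)` (no ratio condition, `a_{j2}` free);
* (T3) ★ `eulerNumeratorTop_roots_Icc_le_one_of_letterSumOne_pos` / `…_of_letterSumZero_neg` — if `B₁ > 0` on the pole-free interval, or
  `B₀ < 0` on it, then `eulerNumerator d a 2` has AT MOST ONE zero there (`q B₀ + (q−p)x^p B₁`, resp. `q x^{−p} B₀ + (q−p) B₁`, strictly isotone)
  — mirror-consistent with the bottom file (`A₁ > 0 ↔ B₁ > 0`, `A₂ < 0 ↔ B₀ < 0` under `0 ↔ 2`).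

HONEST FRAMING: located helper lemmas; type-α windows at the top carry the same riser budget (research); NOT `stub_classRowK3`, not
`OneChangeFloorK3`, not `stub_polyLaw`, not `MatrixDescartes`, not Conjecture B; `VP ≠ VNP` is NOT proved.  No definitions, no named facts.
-/

set_option linter.dupNamespace false

namespace Summit.ValiantsHypothesis.ValiantsHypothesis.Theorems.LacunarySymmetroidMatrixDescartes

namespace ProductPlusOne

open Polynomial Finset
open scoped BigOperators

/-! ### T0 — the top Euler sum through the letter-partial sums -/

/-- The row and its TOP Euler letter in the `(d₀, d₀+p, d₀+q)` form. [folklore] -/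
theorem eval_trinomial_three_top (d0 p q : ℕ) (b : Fin 3 → ℝ) (x : ℝ) :
    (∑ l, C (b l) * X ^ ((![d0, d0 + p, d0 + q] : Fin 3 → ℕ) l) : ℝ[X]).eval x
      = b 0 * x ^ d0 + b 1 * x ^ (d0 + p) + b 2 * x ^ (d0 + q) ∧
    (X * derivative (∑ l, C (b l) * X ^ ((![d0, d0 + p, d0 + q] : Fin 3 → ℕ) l) : ℝ[X])
        - C ((((![d0, d0 + p, d0 + q] : Fin 3 → ℕ) 2 : ℕ) : ℝ)) *
          ∑ l, C (b l) * X ^ ((![d0, d0 + p, d0 + q] : Fin 3 → ℕ) l)).eval x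
      = -(q : ℝ) * b 0 * x ^ d0 - ((q : ℝ) - p) * b 1 * x ^ (d0 + p) := by
  constructor
  · simp [Fin.sum_univ_three]
  · rw [euler_fewnomial]
    simp [Fin.sum_univ_three]
    ring

/-- One row at the top coupling: `x^q·Φ^{top} = −(q·(a₀x^q/g) + (q−p) x^p·(a₁x^q/g))` for `x > 0`, `g = a₀ + a₁x^p + a₂x^q` (also at a pole, by
the `x/0 = 0` convention). [folklore] -/
theorem eulerRatioTop_eq_letterTerms (a₀ a₁ a₂ : ℝ) (d0 p q : ℕ) {x : ℝ} (hx : 0 < x) :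
    x ^ q * ((-(q : ℝ) * a₀ * x ^ d0 - ((q : ℝ) - p) * a₁ * x ^ (d0 + p)) / (a₀ * x ^ d0 + a₁ * x ^ (d0 + p) + a₂ * x ^ (d0 + q)))
      = -((q : ℝ) * (a₀ * x ^ q / (a₀ + a₁ * x ^ p + a₂ * x ^ q))
          + ((q : ℝ) - p) * x ^ p * (a₁ * x ^ q / (a₀ + a₁ * x ^ p + a₂ * x ^ q))) := by
  have hx0 : x ^ d0 ≠ 0 := pow_ne_zero _ hx.ne'
  have hF : a₀ * x ^ d0 + a₁ * x ^ (d0 + p) + a₂ * x ^ (d0 + q) = x ^ d0 * (a₀ + a₁ * x ^ p + a₂ * x ^ q) := by ring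
  rw [hF]
  field_simp
  ring

/-! ### T1 — monotonicity of the letter-partial sums for lower-signed rows -/

/-- Derivative of `c·x^q/(a₀ + a₁x^p + a₂x^q)`:  `c·x^{q−1}·(q a₀ + (q−p) a₁ x^p)/g²` (for `1 ≤ p ≤ q`). [folklore] -/
theorem hasDerivAt_letterTermTop (a₀ a₁ a₂ c : ℝ) (p q : ℕ) (hp : 0 < p) (hpq : p ≤ q) {x : ℝ}
    (hg : a₀ + a₁ * x ^ p + a₂ * x ^ q ≠ 0) :
    HasDerivAt (fun y => c * y ^ q / (a₀ + a₁ * y ^ p + a₂ * y ^ q))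
      (c * x ^ (q - 1) * ((q : ℝ) * a₀ + ((q : ℝ) - p) * a₁ * x ^ p) / (a₀ + a₁ * x ^ p + a₂ * x ^ q) ^ 2) x := by
  have hg' : HasDerivAt (fun y => a₀ + a₁ * y ^ p + a₂ * y ^ q)
      (a₁ * ((p : ℝ) * x ^ (p - 1)) + a₂ * ((q : ℝ) * x ^ (q - 1))) x := by
    have h1 := ((hasDerivAt_pow p x).const_mul a₁).const_add a₀
    have h2 := (hasDerivAt_pow q x).const_mul a₂
    exact h1.add h2
  have hnum : HasDerivAt (fun y => c * y ^ q) (c * ((q : ℝ) * x ^ (q - 1))) x := (hasDerivAt_pow q x).const_mul c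
  have h := hnum.div hg' hg
  refine h.congr_deriv ?_
  obtain ⟨p', rfl⟩ : ∃ p', p = p' + 1 := ⟨p - 1, by omega⟩
  obtain ⟨r, rfl⟩ : ∃ r, q = p' + 1 + r := ⟨q - (p' + 1), by omega⟩
  simp only [Nat.add_sub_cancel, Nat.cast_add, Nat.cast_one]
  have e1 : x ^ (p' + 1) = x ^ p' * x := pow_succ x p'
  have e2 : x ^ (p' + 1 + r - 1) = x ^ p' * x ^ r := by
    rw [show p' + 1 + r - 1 = p' + r by omega, pow_add]
  have e3 : x ^ (p' + 1 + r) = x ^ p' * x * x ^ r := by rw [pow_add, pow_succ]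
  rw [e1, e2, e3]
  field_simp
  ring

/-- **(T1)** For LOWER-SIGNED rows (`a_{j0} a_{j1} ≥ 0`, `1 ≤ p ≤ q`): on a pole-free interval `[u,v] ⊂ (0,∞)` both top-normalised letter
sums `B₀ = Σ_j a_{j0}x^q/g_j` and `B₁ = Σ_j a_{j1}x^q/g_j` are ISOTONE. [folklore; AB1's top twin] -/
theorem letterSumsTop_monotone {m : ℕ} (p q : ℕ) (hp : 0 < p) (hpq : p ≤ q) (a : Fin m → Fin 3 → ℝ)
    (hls : ∀ j, 0 ≤ a j 0 * a j 1) {u v : ℝ} (hu : 0 < u)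
    (hg : ∀ x ∈ Set.Icc u v, ∀ j, a j 0 + a j 1 * x ^ p + a j 2 * x ^ q ≠ 0) :
    MonotoneOn (fun y => ∑ j, a j 0 * y ^ q / (a j 0 + a j 1 * y ^ p + a j 2 * y ^ q)) (Set.Icc u v) ∧
    MonotoneOn (fun y => ∑ j, a j 1 * y ^ q / (a j 0 + a j 1 * y ^ p + a j 2 * y ^ q)) (Set.Icc u v) := by
  have hx0 : ∀ x ∈ Set.Icc u v, 0 < x := fun x hx => hu.trans_le hx.1
  have hqp : 0 ≤ (q : ℝ) - p := by
    have : (p : ℝ) ≤ q := by exact_mod_cast hpq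
    linarith
  have hder : ∀ c : ℝ, ∀ j, ∀ x ∈ Set.Icc u v, HasDerivAt (fun y => c * y ^ q / (a j 0 + a j 1 * y ^ p + a j 2 * y ^ q))
      (c * x ^ (q - 1) * ((q : ℝ) * a j 0 + ((q : ℝ) - p) * a j 1 * x ^ p) / (a j 0 + a j 1 * x ^ p + a j 2 * x ^ q) ^ 2) x :=
    fun c j x hx => hasDerivAt_letterTermTop (a j 0) (a j 1) (a j 2) c p q hp hpq (hg x hx j)
  have hmono : ∀ c : Fin m → ℝ, (∀ j x, x ∈ Set.Icc u v → 0 ≤ c j * ((q : ℝ) * a j 0 + ((q : ℝ) - p) * a j 1 * x ^ p)) →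
      ∀ j, MonotoneOn (fun y => c j * y ^ q / (a j 0 + a j 1 * y ^ p + a j 2 * y ^ q)) (Set.Icc u v) := by
    intro c hc j
    refine monotoneOn_of_deriv_nonneg (convex_Icc u v) ?_ ?_ ?_
    · exact fun x hx => (hder (c j) j x hx).continuousAt.continuousWithinAt
    · rw [interior_Icc]
      exact fun x hx => (hder (c j) j x (Set.Ioo_subset_Icc_self hx)).differentiableAt.differentiableWithinAt
    · rw [interior_Icc]
      intro x hx
      have hxI := Set.Ioo_subset_Icc_self hx
      rw [(hder (c j) j x hxI).deriv]
      refine div_nonneg ?_ (sq_nonneg _)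
      have hxp : 0 ≤ x ^ (q - 1) := pow_nonneg (hx0 x hxI).le _
      have : c j * x ^ (q - 1) * ((q : ℝ) * a j 0 + ((q : ℝ) - p) * a j 1 * x ^ p)
          = x ^ (q - 1) * (c j * ((q : ℝ) * a j 0 + ((q : ℝ) - p) * a j 1 * x ^ p)) := by ring
      rw [this]
      exact mul_nonneg hxp (hc j x hxI)
  have h0 : ∀ j x, x ∈ Set.Icc u v → 0 ≤ a j 0 * ((q : ℝ) * a j 0 + ((q : ℝ) - p) * a j 1 * x ^ p) := by
    intro j x hx
    have : a j 0 * ((q : ℝ) * a j 0 + ((q : ℝ) - p) * a j 1 * x ^ p)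
        = (q : ℝ) * (a j 0 * a j 0) + ((q : ℝ) - p) * (a j 0 * a j 1) * x ^ p := by ring
    rw [this]
    exact add_nonneg (mul_nonneg (Nat.cast_nonneg _) (mul_self_nonneg _))
      (mul_nonneg (mul_nonneg hqp (hls j)) (pow_nonneg (hx0 x hx).le _))
  have h1 : ∀ j x, x ∈ Set.Icc u v → 0 ≤ a j 1 * ((q : ℝ) * a j 0 + ((q : ℝ) - p) * a j 1 * x ^ p) := by
    intro j x hx
    have : a j 1 * ((q : ℝ) * a j 0 + ((q : ℝ) - p) * a j 1 * x ^ p)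
        = (q : ℝ) * (a j 0 * a j 1) + ((q : ℝ) - p) * (a j 1 * a j 1) * x ^ p := by ring
    rw [this]
    exact add_nonneg (mul_nonneg (Nat.cast_nonneg _) (hls j))
      (mul_nonneg (mul_nonneg hqp (mul_self_nonneg _)) (pow_nonneg (hx0 x hx).le _))
  constructor
  · intro x hx y hy hxy
    exact Finset.sum_le_sum fun j _ => hmono (fun j => a j 0) h0 j hx hy hxy
  · intro x hx y hy hxy
    exact Finset.sum_le_sum fun j _ => hmono (fun j => a j 1) h1 j hx hy hxy

/-! ### T3 — at most one zero on type-β windows of the top coupling -/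

/-- The top Euler numerator vanishes at `x > 0` off the poles iff `q B₀(x) + (q−p) x^p B₁(x) = 0`. [folklore] -/
theorem eulerNumeratorTop_eval_eq_zero_iff {m : ℕ} (d0 p q : ℕ) (a : Fin m → Fin 3 → ℝ) {x : ℝ} (hx : 0 < x)
    (hg : ∀ j, a j 0 + a j 1 * x ^ p + a j 2 * x ^ q ≠ 0) :
    (∑ j, (∑ l, C (a j l * (((![d0, d0 + p, d0 + q] : Fin 3 → ℕ) l : ℝ) - (![d0, d0 + p, d0 + q] : Fin 3 → ℕ) 2)) *
        X ^ ((![d0, d0 + p, d0 + q] : Fin 3 → ℕ) l)) *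
      ∏ i ∈ Finset.univ.erase j, (∑ l, C (a i l) * X ^ ((![d0, d0 + p, d0 + q] : Fin 3 → ℕ) l)) : ℝ[X]).eval x = 0 ↔
    (q : ℝ) * (∑ j, a j 0 * x ^ q / (a j 0 + a j 1 * x ^ p + a j 2 * x ^ q))
        + ((q : ℝ) - p) * x ^ p * (∑ j, a j 1 * x ^ q / (a j 0 + a j 1 * x ^ p + a j 2 * x ^ q)) = 0 := by
  classical
  set d : Fin 3 → ℕ := ![d0, d0 + p, d0 + q] with hd
  have hev := fun j => eval_trinomial_three_top d0 p q (a j) x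
  have hxd : x ^ d0 ≠ 0 := pow_ne_zero _ hx.ne'
  have hxq : x ^ q ≠ 0 := pow_ne_zero _ hx.ne'
  have hF : ∀ j, a j 0 * x ^ d0 + a j 1 * x ^ (d0 + p) + a j 2 * x ^ (d0 + q)
      = x ^ d0 * (a j 0 + a j 1 * x ^ p + a j 2 * x ^ q) := fun j => by ring
  have hf : ∀ j, (∑ l, C (a j l) * X ^ (d l) : ℝ[X]).eval x ≠ 0 := by
    intro j h
    rw [(hev j).1, hF j] at h
    exact (mul_ne_zero hxd (hg j)) h
  rw [eval_eulerNumerator_eq_prod_mul_sum d a 2 hf]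
  have hP : (∏ j, (∑ l, C (a j l) * X ^ (d l) : ℝ[X]).eval x) ≠ 0 := Finset.prod_ne_zero_iff.2 fun j _ => hf j
  rw [mul_eq_zero, or_iff_right hP]
  have hsum : (∑ j, (X * derivative (∑ l, C (a j l) * X ^ (d l) : ℝ[X]) - C ((d 2 : ℕ) : ℝ) * ∑ l, C (a j l) * X ^ (d l)).eval x
        / (∑ l, C (a j l) * X ^ (d l) : ℝ[X]).eval x)
      = ∑ j, (-(q : ℝ) * a j 0 * x ^ d0 - ((q : ℝ) - p) * a j 1 * x ^ (d0 + p))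
          / (a j 0 * x ^ d0 + a j 1 * x ^ (d0 + p) + a j 2 * x ^ (d0 + q)) := by
    refine Finset.sum_congr rfl fun j _ => ?_
    rw [(hev j).1, (hev j).2]
  rw [hsum]
  -- multiply by `x^q ≠ 0`
  have key : x ^ q * ∑ j, (-(q : ℝ) * a j 0 * x ^ d0 - ((q : ℝ) - p) * a j 1 * x ^ (d0 + p))
          / (a j 0 * x ^ d0 + a j 1 * x ^ (d0 + p) + a j 2 * x ^ (d0 + q))
      = -((q : ℝ) * (∑ j, a j 0 * x ^ q / (a j 0 + a j 1 * x ^ p + a j 2 * x ^ q))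
          + ((q : ℝ) - p) * x ^ p * (∑ j, a j 1 * x ^ q / (a j 0 + a j 1 * x ^ p + a j 2 * x ^ q))) := by
    rw [Finset.mul_sum, Finset.mul_sum, Finset.mul_sum, ← Finset.sum_add_distrib, ← Finset.sum_neg_distrib]
    exact Finset.sum_congr rfl fun j _ => eulerRatioTop_eq_letterTerms (a j 0) (a j 1) (a j 2) d0 p q hx
  constructor
  · intro h
    have := key
    rw [h, mul_zero] at this
    linarith
  · intro h
    have h2 : x ^ q * ∑ j, (-(q : ℝ) * a j 0 * x ^ d0 - ((q : ℝ) - p) * a j 1 * x ^ (d0 + p))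
          / (a j 0 * x ^ d0 + a j 1 * x ^ (d0 + p) + a j 2 * x ^ (d0 + q)) = 0 := by rw [key, h, neg_zero]
    exact (mul_eq_zero.mp h2).resolve_left hxq

/-- ★ **(T3, letter-1 sum positive)** LOWER-SIGNED company at the TOP coupling (`a_{j0} a_{j1} ≥ 0`, `0 < p < q`), pole-free interval
`[u,v] ⊂ (0,∞)` on which `B₁ = Σ_j a_{j1}x^q/g_j > 0`: the c-free Euler numerator `eulerNumerator d a 2` has AT MOST ONE zero in `[u,v]`.
[this file's theorem] -/
theorem eulerNumeratorTop_roots_Icc_le_one_of_letterSumOne_pos {m : ℕ} (d0 p q : ℕ) (hp : 0 < p) (hpq : p < q)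
    (a : Fin m → Fin 3 → ℝ) (hls : ∀ j, 0 ≤ a j 0 * a j 1) {u v : ℝ} (hu : 0 < u)
    (hg : ∀ x ∈ Set.Icc u v, ∀ j, a j 0 + a j 1 * x ^ p + a j 2 * x ^ q ≠ 0)
    (hB : ∀ x ∈ Set.Icc u v, 0 < ∑ j, a j 1 * x ^ q / (a j 0 + a j 1 * x ^ p + a j 2 * x ^ q)) :
    ((∑ j, (∑ l, C (a j l * (((![d0, d0 + p, d0 + q] : Fin 3 → ℕ) l : ℝ) - (![d0, d0 + p, d0 + q] : Fin 3 → ℕ) 2)) *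
        X ^ ((![d0, d0 + p, d0 + q] : Fin 3 → ℕ) l)) *
      ∏ i ∈ Finset.univ.erase j, (∑ l, C (a i l) * X ^ ((![d0, d0 + p, d0 + q] : Fin 3 → ℕ) l)) : ℝ[X]).roots.toFinset.filter
        (fun t => u ≤ t ∧ t ≤ v)).card ≤ 1 := by
  classical
  set B₀ : ℝ → ℝ := fun y => ∑ j, a j 0 * y ^ q / (a j 0 + a j 1 * y ^ p + a j 2 * y ^ q) with hB₀
  set B₁ : ℝ → ℝ := fun y => ∑ j, a j 1 * y ^ q / (a j 0 + a j 1 * y ^ p + a j 2 * y ^ q) with hB₁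
  obtain ⟨hB₀mono, hB₁mono⟩ := letterSumsTop_monotone p q hp hpq.le a hls hu hg
  have hqp : 0 < (q : ℝ) - p := by
    have : (p : ℝ) < q := by exact_mod_cast hpq
    linarith
  -- `Ξ(x) = q B₀(x) + (q−p) x^p B₁(x)` is strictly isotone on `[u,v]`
  have hΞ : ∀ x ∈ Set.Icc u v, ∀ y ∈ Set.Icc u v, x < y →
      (q : ℝ) * B₀ x + ((q : ℝ) - p) * x ^ p * B₁ x < (q : ℝ) * B₀ y + ((q : ℝ) - p) * y ^ p * B₁ y := by
    intro x hx y hy hxy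
    have hx0 : 0 < x := hu.trans_le hx.1
    have h0 : B₀ x ≤ B₀ y := hB₀mono hx hy hxy.le
    have h1 : B₁ x ≤ B₁ y := hB₁mono hx hy hxy.le
    have hpow : x ^ p < y ^ p := pow_lt_pow_left₀ hxy hx0.le (by omega)
    have hBx : 0 < B₁ x := hB x hx
    have hqR : 0 ≤ (q : ℝ) := Nat.cast_nonneg _
    have step1 : ((q : ℝ) - p) * x ^ p * B₁ x < ((q : ℝ) - p) * y ^ p * B₁ x := by
      have := mul_lt_mul_of_pos_right hpow hBx
      nlinarith
    have step2 : ((q : ℝ) - p) * y ^ p * B₁ x ≤ ((q : ℝ) - p) * y ^ p * B₁ y :=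
      mul_le_mul_of_nonneg_left h1 (mul_nonneg hqp.le (pow_nonneg (hx0.trans hxy).le _))
    have step3 : (q : ℝ) * B₀ x ≤ (q : ℝ) * B₀ y := mul_le_mul_of_nonneg_left h0 hqR
    linarith
  have hroot : ∀ t, t ∈ ((∑ j, (∑ l, C (a j l * (((![d0, d0 + p, d0 + q] : Fin 3 → ℕ) l : ℝ)
        - (![d0, d0 + p, d0 + q] : Fin 3 → ℕ) 2)) * X ^ ((![d0, d0 + p, d0 + q] : Fin 3 → ℕ) l)) *
      ∏ i ∈ Finset.univ.erase j, (∑ l, C (a i l) * X ^ ((![d0, d0 + p, d0 + q] : Fin 3 → ℕ) l)) : ℝ[X]).roots.toFinset.filter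
        (fun t => u ≤ t ∧ t ≤ v)) → (q : ℝ) * B₀ t + ((q : ℝ) - p) * t ^ p * B₁ t = 0 := by
    intro t ht
    rw [Finset.mem_filter, Multiset.mem_toFinset] at ht
    obtain ⟨hrt, htI⟩ := ht
    have htI' : t ∈ Set.Icc u v := htI
    have ht0 : 0 < t := hu.trans_le htI.1
    have hev := (mem_roots (ne_zero_of_mem_roots hrt)).mp hrt
    exact (eulerNumeratorTop_eval_eq_zero_iff d0 p q a ht0 (hg t htI')).mp hev
  rw [Finset.card_le_one]
  intro t₁ ht₁ t₂ ht₂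
  have h1 := hroot t₁ ht₁
  have h2 := hroot t₂ ht₂
  have ht₁I : t₁ ∈ Set.Icc u v := (Finset.mem_filter.mp ht₁).2
  have ht₂I : t₂ ∈ Set.Icc u v := (Finset.mem_filter.mp ht₂).2
  by_contra hne
  rcases lt_or_gt_of_ne hne with h | h
  · have := hΞ t₁ ht₁I t₂ ht₂I h; linarith
  · have := hΞ t₂ ht₂I t₁ ht₁I h; linarith

/-- ★ **(T3, letter-0 sum negative)** LOWER-SIGNED company at the TOP coupling, pole-free interval `[u,v] ⊂ (0,∞)` on which
`B₀ = Σ_j a_{j0}x^q/g_j < 0`: `eulerNumerator d a 2` has AT MOST ONE zero in `[u,v]` (`q x^{−p} B₀ + (q−p) B₁` strictly isotone).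
[this file's theorem] -/
theorem eulerNumeratorTop_roots_Icc_le_one_of_letterSumZero_neg {m : ℕ} (d0 p q : ℕ) (hp : 0 < p) (hpq : p < q)
    (a : Fin m → Fin 3 → ℝ) (hls : ∀ j, 0 ≤ a j 0 * a j 1) {u v : ℝ} (hu : 0 < u)
    (hg : ∀ x ∈ Set.Icc u v, ∀ j, a j 0 + a j 1 * x ^ p + a j 2 * x ^ q ≠ 0)
    (hB : ∀ x ∈ Set.Icc u v, ∑ j, a j 0 * x ^ q / (a j 0 + a j 1 * x ^ p + a j 2 * x ^ q) < 0) :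
    ((∑ j, (∑ l, C (a j l * (((![d0, d0 + p, d0 + q] : Fin 3 → ℕ) l : ℝ) - (![d0, d0 + p, d0 + q] : Fin 3 → ℕ) 2)) *
        X ^ ((![d0, d0 + p, d0 + q] : Fin 3 → ℕ) l)) *
      ∏ i ∈ Finset.univ.erase j, (∑ l, C (a i l) * X ^ ((![d0, d0 + p, d0 + q] : Fin 3 → ℕ) l)) : ℝ[X]).roots.toFinset.filter
        (fun t => u ≤ t ∧ t ≤ v)).card ≤ 1 := by
  classical
  set B₀ : ℝ → ℝ := fun y => ∑ j, a j 0 * y ^ q / (a j 0 + a j 1 * y ^ p + a j 2 * y ^ q) with hB₀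
  set B₁ : ℝ → ℝ := fun y => ∑ j, a j 1 * y ^ q / (a j 0 + a j 1 * y ^ p + a j 2 * y ^ q) with hB₁
  obtain ⟨hB₀mono, hB₁mono⟩ := letterSumsTop_monotone p q hp hpq.le a hls hu hg
  have hqp : 0 ≤ (q : ℝ) - p := by
    have : (p : ℝ) < q := by exact_mod_cast hpq
    linarith
  -- `Ξ(x) = q x^{−p} B₀(x) + (q−p) B₁(x)` is strictly isotone on `[u,v]`
  have hΞ : ∀ x ∈ Set.Icc u v, ∀ y ∈ Set.Icc u v, x < y →
      (q : ℝ) * (x ^ p)⁻¹ * B₀ x + ((q : ℝ) - p) * B₁ x < (q : ℝ) * (y ^ p)⁻¹ * B₀ y + ((q : ℝ) - p) * B₁ y := by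
    intro x hx y hy hxy
    have hx0 : 0 < x := hu.trans_le hx.1
    have h0 : B₀ x ≤ B₀ y := hB₀mono hx hy hxy.le
    have h1 : B₁ x ≤ B₁ y := hB₁mono hx hy hxy.le
    have hpow : x ^ p < y ^ p := pow_lt_pow_left₀ hxy hx0.le (by omega)
    have hxp : 0 < x ^ p := pow_pos hx0 _
    have hyp : 0 < y ^ p := pow_pos (hx0.trans hxy) _
    have hinv : (y ^ p)⁻¹ < (x ^ p)⁻¹ := inv_strictAnti₀ hxp hpow
    have hBx : B₀ x < 0 := hB x hx
    have hBy : B₀ y < 0 := hB y hy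
    have hqR : 0 < (q : ℝ) := by exact_mod_cast (hp.trans hpq)
    -- `q x⁻ᵖ B₀(x) = −q x⁻ᵖ |B₀ x|`: larger `x⁻ᵖ` and larger `|B₀ x|` at `x` ⇒ smaller value at `x`
    have step1 : (q : ℝ) * (x ^ p)⁻¹ * B₀ x < (q : ℝ) * (y ^ p)⁻¹ * B₀ x := by
      have hneg : 0 < -B₀ x := by linarith
      have := mul_lt_mul_of_pos_right hinv (mul_pos hqR hneg)
      nlinarith
    have step2 : (q : ℝ) * (y ^ p)⁻¹ * B₀ x ≤ (q : ℝ) * (y ^ p)⁻¹ * B₀ y :=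
      mul_le_mul_of_nonneg_left h0 (mul_nonneg hqR.le (inv_nonneg.mpr hyp.le))
    have step3 : ((q : ℝ) - p) * B₁ x ≤ ((q : ℝ) - p) * B₁ y := mul_le_mul_of_nonneg_left h1 hqp
    linarith
  have hroot : ∀ t, t ∈ ((∑ j, (∑ l, C (a j l * (((![d0, d0 + p, d0 + q] : Fin 3 → ℕ) l : ℝ)
        - (![d0, d0 + p, d0 + q] : Fin 3 → ℕ) 2)) * X ^ ((![d0, d0 + p, d0 + q] : Fin 3 → ℕ) l)) *
      ∏ i ∈ Finset.univ.erase j, (∑ l, C (a i l) * X ^ ((![d0, d0 + p, d0 + q] : Fin 3 → ℕ) l)) : ℝ[X]).roots.toFinset.filter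
        (fun t => u ≤ t ∧ t ≤ v)) → (q : ℝ) * (t ^ p)⁻¹ * B₀ t + ((q : ℝ) - p) * B₁ t = 0 := by
    intro t ht
    rw [Finset.mem_filter, Multiset.mem_toFinset] at ht
    obtain ⟨hrt, htI⟩ := ht
    have htI' : t ∈ Set.Icc u v := htI
    have ht0 : 0 < t := hu.trans_le htI.1
    have hev := (mem_roots (ne_zero_of_mem_roots hrt)).mp hrt
    have hz := (eulerNumeratorTop_eval_eq_zero_iff d0 p q a ht0 (hg t htI')).mp hev
    have htp : t ^ p ≠ 0 := pow_ne_zero _ ht0.ne'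
    have : (q : ℝ) * (t ^ p)⁻¹ * B₀ t + ((q : ℝ) - p) * B₁ t
        = ((q : ℝ) * B₀ t + ((q : ℝ) - p) * t ^ p * B₁ t) / t ^ p := by
      field_simp
    rw [this, hz, zero_div]
  rw [Finset.card_le_one]
  intro t₁ ht₁ t₂ ht₂
  have h1 := hroot t₁ ht₁
  have h2 := hroot t₂ ht₂
  have ht₁I : t₁ ∈ Set.Icc u v := (Finset.mem_filter.mp ht₁).2
  have ht₂I : t₂ ∈ Set.Icc u v := (Finset.mem_filter.mp ht₂).2
  by_contra hne
  rcases lt_or_gt_of_ne hne with h | h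
  · have := hΞ t₁ ht₁I t₂ ht₂I h; linarith
  · have := hΞ t₂ ht₂I t₁ ht₁I h; linarith

end ProductPlusOne

end Summit.ValiantsHypothesis.ValiantsHypothesis.Theorems.LacunarySymmetroidMatrixDescartes
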